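import Summits.HubbardSuperconductivity.HubbardSuperconductivity.Theorems.InfiniteVolumeFirstNoNormalLimitStateStubCofinalLroTransfer
import Summits.HubbardSuperconductivity.HubbardSuperconductivity.Theorems.WeakCouplingBCSWcbcsThesisGlue
import Literature.Barriers.HubbardSuperconductivity.PureModelStripeCompetition

/-!
# Crux `NoNormalLimitState` (stmt-HubbardSuperconductivity-18533, route `InfiniteVolumeFirst`) —
# the crux follows from the weak-coupling target of route `WeakCouplingBCS`

A certified dependency edge between two routes of the summit.  The target `X` of route
`WeakCouplingBCS` (`WcbcsThesis`, item stmt-HubbardSuperconductivity-2007) reads: there are `U₀ > 0`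
and a hole doping `δ ∈ (0, 1/2)` such that for EVERY `U ∈ (0, U₀)` the summit matrix
`HasDWavePairFieldLROAt U δ` holds (every admissible `(N_L, S^z = 0)`-sector ground-state family of
`hubbardTorus 2 L 1 U` has `d_{x²-y²}` pair-field long-range order along even sides).  A coupling
window `(0, U₀)` at one doping is in particular a set of couplings accumulating at `0⁺` at that
doping, so the landed transfer `NoNormalLimitState.stub_cofinalLroTransfer` (even-side LRO ⇒ positive
condensate atom of every pointwise torus limit, for every family; cofinally in `U` ⇒ the crux) gives

* `stub_weakCouplingWindowLroTransfer` : `X → NoNormalLimitState`, and, composed with the landed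
  structural glue `wcbcsThesisGlue_proof` (crux 2 → crux 4 → X of that route),
* `noNormalLimitState_of_wcbcsCruxes` : `WcbcsSsbToTorusLRO → WcbcsBcsConstruction → NoNormalLimitState`.

So the `InfiniteVolumeFirst` crux `NoNormalLimitState` is settled the moment the weak-coupling
programme (constructive BCS/Kohn–Luttinger ground state + SSB ⇒ LRO transfer) closes its target; it
asks for nothing that programme does not already promise.  (The converse fails: the crux constrains
only torus LIMITS and one cofinal sequence of couplings.)

DESIGN.  As requested by the `WeakCouplingBCS` route text ("do NOT import …Theses.WeakCouplingBCS"),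
the hypotheses are the verbatim BODIES of `WcbcsThesis`, `WcbcsSsbToTorusLRO`, `WcbcsBcsConstruction`
(Theses/WeakCouplingBCS.lean rev 4), spelled out structurally over the audited Literature vocabulary
(`HasDWavePairFieldLROAt`, `HasDWaveOrder`, `dWaveOrderParameter`, `hubbardTorusWith`); the
conclusion is this route's decl BY NAME.  Pure logic; no definition and no named fact is introduced.
-/

noncomputable section

-- the mandated namespace `Summit.<Summit>.<Problem>.Theorems` repeats `HubbardSuperconductivity`
-- (single-problem summit, D-0017), which the `dupNamespace` linter flags on every declaration
set_option linter.dupNamespace false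

namespace Summit.HubbardSuperconductivity.HubbardSuperconductivity.Theorems.NoNormalLimitState

open Literature.MathematicalPhysics.QuantumLattice Literature.Probability.LatticeModels Filter

/-- **The weak-coupling target of route `WeakCouplingBCS` implies the crux.** If there are `U₀ > 0`
and `δ ∈ (0, 1/2)` such that for every `U ∈ (0, U₀)` every admissible sector ground-state family of
`hubbardTorus 2 L 1 U` at doping `δ` has `d_{x²-y²}` pair-field LRO along even sides
(`HasDWavePairFieldLROAt U δ` — the hypothesis is word for word the body of `WcbcsThesis`,
stmt-HubbardSuperconductivity-2007), then `NoNormalLimitState`: at that `δ`, for every `U₀' > 0` the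
coupling `U := min U₀' U₀ / 2` lies in both windows, and `stub_cofinalLroTransfer` (LRO ⇒ atom of
every limit, Portmanteau direction of the Fejér exchange) concludes. [folklore] -/
theorem stub_weakCouplingWindowLroTransfer :
    (∃ U₀ : ℝ, 0 < U₀ ∧ ∃ δ ∈ Set.Ioo (0:ℝ) (1 / 2), ∀ U ∈ Set.Ioo (0:ℝ) U₀,
        Literature.Barriers.HubbardSuperconductivity.HasDWavePairFieldLROAt U δ) →
      Summit.HubbardSuperconductivity.HubbardSuperconductivity.Theses.InfiniteVolumeFirst.NoNormalLimitState := by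
  rintro ⟨U₁, hU₁, δ, hδ, hX⟩
  refine stub_cofinalLroTransfer ⟨δ, hδ, fun U₀ hU₀ => ?_⟩
  have hmin : 0 < min U₀ U₁ := lt_min hU₀ hU₁
  refine ⟨min U₀ U₁ / 2, ⟨half_pos hmin, (half_lt_self hmin).trans_le (min_le_left _ _)⟩, ?_⟩
  exact hX (min U₀ U₁ / 2) ⟨half_pos hmin, (half_lt_self hmin).trans_le (min_le_right _ _)⟩

/-- **The two cruxes of route `WeakCouplingBCS` imply the crux.** Hypotheses: the verbatim bodies of
`WcbcsSsbToTorusLRO` (stmt-HubbardSuperconductivity-2009: in a weak-coupling window, density matching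
of the grand-canonical tracial ground state of `hubbardTorusWith 2 (L+1) 1 U μ` and Koma–Tasaki
`d`-wave order `HasDWaveOrder U μ` give `HasDWavePairFieldLROAt U δ`) and of `WcbcsBcsConstruction`
(stmt-HubbardSuperconductivity-2010: at one `δ ∈ (0,1/2)`, for all `U ∈ (0,U₀)` a density-matched
`μ` with `dWaveOrderParameter U μ ≥ exp (-C/U²)`).  The landed structural glue
`wcbcsThesisGlue_proof` turns them into the body of `WcbcsThesis`, and
`stub_weakCouplingWindowLroTransfer` concludes. [folklore] -/
theorem noNormalLimitState_of_wcbcsCruxes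
    (h2 : ∃ U₀ : ℝ, 0 < U₀ ∧ ∀ U ∈ Set.Ioo (0:ℝ) U₀, ∀ δ ∈ Set.Ioo (0:ℝ) (1 / 2), ∀ μ : ℝ,
      Filter.Tendsto (fun L : ℕ => ((hubbardTorusWith 2 (L + 1) 1 U μ).groundStateFunctional
        totalNumber).re / ((L + 1 : ℕ) : ℝ) ^ 2) Filter.atTop (nhds (1 - δ)) →
      HasDWaveOrder U μ → Literature.Barriers.HubbardSuperconductivity.HasDWavePairFieldLROAt U δ)
    (h4 : ∃ δ ∈ Set.Ioo (0:ℝ) (1 / 2), ∃ U₀ : ℝ, 0 < U₀ ∧ ∃ C : ℝ, 0 < C ∧ ∀ U ∈ Set.Ioo (0:ℝ) U₀,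
      ∃ μ : ℝ, Filter.Tendsto (fun L : ℕ => ((hubbardTorusWith 2 (L + 1) 1 U μ).groundStateFunctional
        totalNumber).re / ((L + 1 : ℕ) : ℝ) ^ 2) Filter.atTop (nhds (1 - δ)) ∧
        Real.exp (-C / U ^ 2) ≤ dWaveOrderParameter U μ) :
    Summit.HubbardSuperconductivity.HubbardSuperconductivity.Theses.InfiniteVolumeFirst.NoNormalLimitState :=
  stub_weakCouplingWindowLroTransfer (wcbcsThesisGlue_proof h2 h4)

end Summit.HubbardSuperconductivity.HubbardSuperconductivity.Theorems.NoNormalLimitState
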